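import Literature.MathematicalPhysics.KineticTheory.HardSphereEuler
import Literature.Analysis.FluidPDE.HardSphereCollisionRecord
import HarnessLib

/-!
# Record gain bound (stub `stub_recordGain`, K1 of the line `coboundary-hot-cold-split`)

Crux `Summit.AtomisticToContinuum.HydrodynamicLimit.Theses.OneFlightGossipEngine.EnergyActivityTails`
(stmt-AtomisticToContinuum-17703), line `Sketch` (card `coboundary-hot-cold-split`), registered stub
`stub_recordGain : RecordGain` (the defs `Cfg`, `RecordGain` re-declared verbatim from the line skeleton).

**K1 — record kinematics at contact.** For the record `c = ofConfig G ε z t i j` read off a contact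
configuration `z` of `N + 1` spheres of diameter `ε = hsDiameter σ N > 0` on `𝕋³`
(`c.postVel = (v_i, v_j)`, `c.preVel = reflectVel n (v_i, v_j)`, `c.impactVec = ε⁻¹ • n`, `n = G.sepVec x_i x_j`,
`‖n‖ = ε` at contact): the positive part of the first partner's kinetic-energy gain is at most its momentum
impulse times the PARTNER's incoming normal speed,
`((‖v_i⁺‖² − ‖v_i⁻‖²)/2)⁺ ≤ ‖v_i⁺ − v_i⁻‖ · |⟪v_j⁻, ω⟫|`, `ω = c.impactVec` (a unit vector at contact).

Proof: pure inner-product algebra of the elastic law `reflectVel` (§1, adapted from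
`Cruxes/EnergyActivityTails/IdeatorOneSketch.lean` §2): the normal components of the pair are SWAPPED
(`inner_reflectVel_fst`, `inner_reflectVel_snd`), the energy jump of `fst` is
`(ν_snd² − ν_fst²)/‖n‖²` and its velocity jump has size `|ν_snd − ν_fst|/‖n‖` (`ν` = incoming normal components
along the unnormalised `n`), and `max ((A² − B²)/2) 0 ≤ |A − B|·|A|`; then (§2) instantiate at
`n = G.sepVec x_i x_j ≠ 0`, `‖n‖ = ε`, `|⟪w, ε⁻¹ • n⟫| = |⟪w, n⟫|/‖n‖`.

References: I. Gallagher, L. Saint-Raymond, B. Texier, *From Newton to Boltzmann* (2013) §1.1 (1.1.2)–(1.1.3), §4.1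
(elastic law, collision marks); C. Cercignani, R. Illner, M. Pulvirenti (1994) §4.2. The lemmas are elementary.
-/

noncomputable section

open scoped InnerProductSpace

namespace Summit.AtomisticToContinuum.HydrodynamicLimit.Theorems.EnergyActivityTailsRecordGain

open Literature.MathematicalPhysics.KineticTheory Literature.Analysis.FluidPDE

/-! ## §0 The statement (verbatim from the line skeleton) -/

/-- Configurations of `N + 1` spheres on `𝕋³`. -/
abbrev Cfg (N : ℕ) : Type := Config (N + 1) (Fin 3) T3

/-- **K1 — RECORD GAIN BOUND (record kinematics at contact).** For a record read off a contact configuration of `N + 1`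
spheres of diameter `hsDiameter σ N > 0`: the positive part of the first partner's energy gain is at most its momentum
impulse times the partner's incoming normal speed, `g⁺ ≤ ‖v_fst⁺ − v_fst⁻‖ · |⟪v_snd⁻, ω⟫|` (the elastic law swaps the normal
components, `g = (ν_snd² − ν_fst²)/2`, `‖Δv_fst‖ = |ν_snd − ν_fst|`, `‖ω‖ = 1`) (registered stub signature of line Sketch,
crux EnergyActivityTails (stmt-AtomisticToContinuum-17703) — route-internal, not a cited fact). -/
def RecordGain : Prop :=
  ∀ (σ : ℝ), 0 < σ → ∀ (N : ℕ) (z : Cfg N) (t : ℝ) (i j : Fin (N + 1)),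
    z ∈ contactSet (Torus.geometry (Fin 3)) (N + 1) (hsDiameter σ N) i j →
    max ((‖(HardSphereCollisionRecord.ofConfig (Torus.geometry (Fin 3)) (hsDiameter σ N) z t i j).postVel.1‖ ^ 2 -
          ‖(HardSphereCollisionRecord.ofConfig (Torus.geometry (Fin 3)) (hsDiameter σ N) z t i j).preVel.1‖ ^ 2) / 2) 0 ≤
      ‖(HardSphereCollisionRecord.ofConfig (Torus.geometry (Fin 3)) (hsDiameter σ N) z t i j).postVel.1 -
          (HardSphereCollisionRecord.ofConfig (Torus.geometry (Fin 3)) (hsDiameter σ N) z t i j).preVel.1‖ *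
        |⟪(HardSphereCollisionRecord.ofConfig (Torus.geometry (Fin 3)) (hsDiameter σ N) z t i j).preVel.2,
          (HardSphereCollisionRecord.ofConfig (Torus.geometry (Fin 3)) (hsDiameter σ N) z t i j).impactVec⟫_ℝ|

/-! ## §1 The inner-product core: kinematics of `reflectVel` (adapted from
`Cruxes/EnergyActivityTails/IdeatorOneSketch.lean` §2) -/

section Kinematics

variable {E : Type*} [NormedAddCommGroup E] [InnerProductSpace ℝ E]

/-- Post-collisional normal component of `fst` = pre-collisional normal component of `snd`: the normal components
are SWAPPED by the elastic law (`n ≠ 0`). Adapted from `Cruxes/EnergyActivityTails/IdeatorOneSketch.lean`. -/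
theorem inner_reflectVel_fst (n : E) (hn : n ≠ 0) (p : E × E) :
    ⟪(reflectVel n p).1, n⟫_ℝ = ⟪p.2, n⟫_ℝ := by
  have hn' : ‖n‖ ^ 2 ≠ 0 := pow_ne_zero 2 (norm_ne_zero_iff.2 hn)
  simp only [reflectVel, inner_sub_left, inner_smul_left, real_inner_self_eq_norm_sq, RCLike.conj_to_real]
  field_simp
  ring

/-- The jump of `fst`'s velocity is along `n`, of size the difference of the two normal components:
`p.1 - (reflectVel n p).1 = ((⟪p.1, n⟫ - ⟪p.2, n⟫)/‖n‖²) • n`.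
Adapted from `Cruxes/EnergyActivityTails/IdeatorOneSketch.lean`. -/
theorem fst_sub_reflectVel_fst (n : E) (p : E × E) :
    p.1 - (reflectVel n p).1 = ((⟪p.1, n⟫_ℝ - ⟪p.2, n⟫_ℝ) / ‖n‖ ^ 2) • n := by
  simp only [reflectVel, inner_sub_left, sub_sub_cancel, sub_div]

/-- **K1(a)** — the energy jump of `fst` is (own outgoing normal energy) − (own incoming normal energy):
`‖v⁺‖² − ‖v⁻‖² = (⟪v⁺, n⟫² − ⟪v⁻, n⟫²)/‖n‖²` for `v⁻ = (reflectVel n (v⁺, w⁺)).1`, `n ≠ 0`.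
Adapted from `Cruxes/EnergyActivityTails/IdeatorOneSketch.lean`. -/
theorem norm_sq_fst_sub_norm_sq_reflectVel_fst (n : E) (hn : n ≠ 0) (p : E × E) :
    ‖p.1‖ ^ 2 - ‖(reflectVel n p).1‖ ^ 2 =
      (⟪p.1, n⟫_ℝ ^ 2 - ⟪(reflectVel n p).1, n⟫_ℝ ^ 2) / ‖n‖ ^ 2 := by
  have hn' : ‖n‖ ^ 2 ≠ 0 := pow_ne_zero 2 (norm_ne_zero_iff.2 hn)
  set a := (⟪p.1, n⟫_ℝ - ⟪p.2, n⟫_ℝ) / ‖n‖ ^ 2 with ha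
  have hpre : (reflectVel n p).1 = p.1 - a • n := by
    rw [ha, ← fst_sub_reflectVel_fst n p]; abel
  rw [inner_reflectVel_fst n hn p, hpre, @norm_sub_sq_real, norm_smul, inner_smul_right, Real.norm_eq_abs,
    mul_pow, sq_abs]
  rw [ha]
  field_simp
  ring

/-- Pre-collisional normal component of `snd` = post-collisional normal component of `fst` (the swap, read from the
other side; `n ≠ 0`). Adapted from `Cruxes/EnergyActivityTails/IdeatorOneSketch.lean`. -/
theorem inner_reflectVel_snd (n : E) (hn : n ≠ 0) (p : E × E) :
    ⟪(reflectVel n p).2, n⟫_ℝ = ⟪p.1, n⟫_ℝ := by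
  have hn' : ‖n‖ ^ 2 ≠ 0 := pow_ne_zero 2 (norm_ne_zero_iff.2 hn)
  simp only [reflectVel, inner_add_left, inner_smul_left, real_inner_self_eq_norm_sq, RCLike.conj_to_real]
  field_simp
  rw [inner_sub_left]
  ring

/-- The size of `fst`'s velocity jump is `|ν_snd − ν_fst| / ‖n‖` (difference of the incoming normal components along the
unnormalised direction `n ≠ 0`). Adapted from `Cruxes/EnergyActivityTails/IdeatorOneSketch.lean`. -/
theorem norm_fst_sub_reflectVel_fst (n : E) (hn : n ≠ 0) (p : E × E) :
    ‖p.1 - (reflectVel n p).1‖ = |⟪(reflectVel n p).2, n⟫_ℝ - ⟪(reflectVel n p).1, n⟫_ℝ| / ‖n‖ := by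
  have hn0 : 0 < ‖n‖ := norm_pos_iff.2 hn
  rw [fst_sub_reflectVel_fst, norm_smul, Real.norm_eq_abs, abs_div, abs_of_pos (pow_pos hn0 2),
    inner_reflectVel_snd n hn, inner_reflectVel_fst n hn]
  field_simp

/-- Scalar core of K1(b): `max ((A² − B²)/2) 0 ≤ |A − B|·|A|` (`A² − B² = 2A(A − B) − (A − B)²`).
Adapted from `Cruxes/EnergyActivityTails/IdeatorOneSketch.lean`. -/
theorem max_half_sq_sub_sq_le (A B : ℝ) : max ((A ^ 2 - B ^ 2) / 2) 0 ≤ |A - B| * |A| := by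
  refine max_le ?_ (by positivity)
  have h1 : (A ^ 2 - B ^ 2) / 2 ≤ (A - B) * A := by nlinarith [sq_nonneg (A - B)]
  exact h1.trans (by rw [← abs_mul]; exact le_abs_self _)

/-- **K1(b), abstract form — GAIN ≤ IMPULSE × PARTNER'S NORMAL SPEED**:
`((‖v⁺‖² − ‖v⁻‖²)/2)⁺ ≤ ‖v⁺ − v⁻‖ · (|⟪w⁻, n⟫|/‖n‖)` for `(v⁻, w⁻) = reflectVel n (v⁺, w⁺)`, `n ≠ 0`.
Adapted from `Cruxes/EnergyActivityTails/IdeatorOneSketch.lean`. -/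
theorem gain_pos_le_impulse_mul_partnerNormal (n : E) (hn : n ≠ 0) (p : E × E) :
    max ((‖p.1‖ ^ 2 - ‖(reflectVel n p).1‖ ^ 2) / 2) 0 ≤
      ‖p.1 - (reflectVel n p).1‖ * (|⟪(reflectVel n p).2, n⟫_ℝ| / ‖n‖) := by
  have hn0 : 0 < ‖n‖ := norm_pos_iff.2 hn
  have hn2 : 0 < ‖n‖ ^ 2 := pow_pos hn0 2
  set A := ⟪(reflectVel n p).2, n⟫_ℝ with hA
  set B := ⟪(reflectVel n p).1, n⟫_ℝ with hB
  have hjump : ‖p.1‖ ^ 2 - ‖(reflectVel n p).1‖ ^ 2 = (A ^ 2 - B ^ 2) / ‖n‖ ^ 2 := by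
    rw [norm_sq_fst_sub_norm_sq_reflectVel_fst n hn p, ← inner_reflectVel_snd n hn p]
  rw [hjump, norm_fst_sub_reflectVel_fst n hn p, ← hA, ← hB]
  have key' : (A ^ 2 - B ^ 2) / 2 ≤ |A - B| * |A| := (le_max_left _ _).trans (max_half_sq_sub_sq_le A B)
  refine max_le ?_ (by positivity)
  have hre : (A ^ 2 - B ^ 2) / ‖n‖ ^ 2 / 2 = ((A ^ 2 - B ^ 2) / 2) / ‖n‖ ^ 2 := by ring
  rw [hre, div_le_iff₀ hn2]
  have hne : ‖n‖ ≠ 0 := hn0.ne'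
  calc (A ^ 2 - B ^ 2) / 2 ≤ |A - B| * |A| := key'
    _ = |A - B| / ‖n‖ * (|A| / ‖n‖) * ‖n‖ ^ 2 := by field_simp

end Kinematics

/-! ## §2 The stub -/

/-- **Stub K1 (registered): the record gain bound.** At contact the separation vector `n = G.sepVec x_i x_j` has norm
`hsDiameter σ N > 0` (`mem_contactSet`, `hsDiameter_pos`), so `n ≠ 0` and `|⟪w, ε⁻¹ • n⟫| = |⟪w, n⟫| / ‖n‖`; the record's
`postVel`, `preVel`, `impactVec` are `(v_i, v_j)`, `reflectVel n (v_i, v_j)`, `ε⁻¹ • n` (`HardSphereCollisionRecord.ofConfig`),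
and `gain_pos_le_impulse_mul_partnerNormal` concludes. -/
theorem stub_recordGain : RecordGain := by
  intro σ hσ N z t i j hz
  have hε : 0 < hsDiameter σ N := hsDiameter_pos hσ N
  have hnorm : ‖(Torus.geometry (Fin 3)).sepVec (z i).1 (z j).1‖ = hsDiameter σ N := (mem_contactSet.1 hz).2
  have hn : (Torus.geometry (Fin 3)).sepVec (z i).1 (z j).1 ≠ 0 := by
    intro h0
    rw [h0, norm_zero] at hnorm
    exact hε.ne' hnorm.symm
  simp only [HardSphereCollisionRecord.ofConfig_postVel, HardSphereCollisionRecord.ofConfig_preVel,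
    HardSphereCollisionRecord.ofConfig_impactVec]
  rw [real_inner_smul_right, abs_mul, abs_inv, abs_of_pos hε, ← hnorm, inv_mul_eq_div]
  exact gain_pos_le_impulse_mul_partnerNormal _ hn ((z i).2, (z j).2)

end Summit.AtomisticToContinuum.HydrodynamicLimit.Theorems.EnergyActivityTailsRecordGain

end
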